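import Literature.AnabelianGeometry.EtaleTheta.Discharge.Sec1DeltaThetaTateTwistExact
import Literature.AnabelianGeometry.EtaleTheta.SettingBridgeCuspLaws
import HarnessLib

/-!
# [EtTh] Def. 2.1 / [SemiAnbd] §6 «`I_x ≅ Ẑ(1)`» as a TOPOLOGICAL Galois-module isomorphism, DERIVED at a joint origin:
# at `IsTateOrigin` + R2 + the cusp law C3 the inertia of the cusp is `≃ₜ* Ẑ` EQUIVARIANTLY for the cyclotomic character

Mochizuki, *The étale theta function …*, Publ. RIMS **45** (2009) [EtTh], Def. 2.1 p. 35 («`D_x → Π^Θ_X` … maps the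
inertia group `I_x ⊆ D_x` isomorphically onto `Δ_Θ`», «`1 → Δ_Θ → D̄_x → G_K → 1`»), §1 p. 12 «`(Ẑ(1) ≅) Δ_Θ`»
[cite: MochizukiEtTh2009, Def 2.1 p.35]; [SemiAnbd] §6 p. 71 «`I_x` is isomorphic to `Ẑ(1)` if `x` is a cusp»
[cite: MochizukiSemiAnbd2006, §6 p.71]; Ribes–Zalesskii, *Profinite Groups*, Thm. 2.7.1 (`Ẑ`) [cite: RibesZalesskii2010, Thm 2.7.1].
abc-iut cell, layer L2, seat abc-iut-w5-d051 (gen 4; NV / §1-interface lane); PROOF-ONLY sequel of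
`Sec1DeltaThetaTateTwistExact.lean` (p457285).

WHAT.  The root interface types the cusp inertia as ABSTRACTLY `≃ₜ* Ẑ` (`TemperedCurve.inertia_equiv_zHat`), with no
Galois-module clause; abc-iut-w5-d029's census item C7e types «the cusp is cyclotomic» as a predicate
(`GalSect.CuspPair.IsCyclotomic`: `∃ e : I ≃ₜ* Ẑ, e(d i d⁻¹) = χ(α d) · e(i)`).  HERE the `ThetaSetting`-side statement
is DERIVED from the §1 origin clauses: at `IsEtThOrigin` + `hYcl` + `IsTateOrigin` + R2 (every `N`) + C3
(`toTheta(I_x) = Δ_Θ`) for a cusp `x` with `D_x ⊆ Π^tp_Y`,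

* `ThetaSetting.zHat_monoidHom_injective_of_surjective` — an ABSTRACT surjective endomorphism of `Ẑ` is injective
  (its level-`n` multipliers are units: `ZHatLevel.level_map`, `ext_of_level`);
* **`ThetaSetting.IsTateOrigin.exists_cyclotomic_inertia_equiv`** — `∃ e : I_x ≃ₜ* Ẑ` with
  `e(d w d⁻¹) = χ(aug d) (e w)` for all `d ∈ D_x`, `w ∈ I_x` (`χ = SettingModel.chi p`).  Construction: `e := ψ ∘ θ|_{I_x}`
  for any `ψ : Δ_Θ ≃* Ẑ` (p457285's inertia character, `χ`-equivariant by `inertiaCharacter_eq_chi`, onto by C3);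
  composing with the root's abstract `I_x ≃ₜ* Ẑ` gives an abstract surjective endomorphism of `Ẑ` — injective by the
  above and continuous by abc-iut-L4's `ZHatLevel.continuous_monoidHom` — so `e` is a continuous bijection from the
  compact `I_x` to the Hausdorff `Ẑ`, a topological isomorphism;
* joint-origin forms `exists_cyclotomic_inertia_equiv_of_origins` (`IsThm16Origin` for R2, abc-iut-L2-t7's `CuspLaws`
  for C3) and `…_of_oncePuncturedData` ((P3) by name).

PROOF-ONLY: no definition, no instance, no named fact; nothing restated.  HONEST FRAMING: interface law over the frozen
root; `IsEtThOrigin`, `hYcl`, the origin predicates and C3 are hypotheses inhabited only at models (and, by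
`Sec1NoCentralCuspAtJointOrigin`, at no product-type cusp carrier); nothing of [EtTh]/[SemiAnbd] is asserted for
genuine tempered fundamental groups; no side is taken on [IUTchIII] Cor. 3.12; typed ≠ proved.
-/

noncomputable section

namespace Literature.AnabelianGeometry.EtaleTheta

open Literature.AnabelianGeometry.SemiGraphs Thm16Sub
open scoped Pointwise

namespace ThetaSetting

variable {p : ℕ} [Fact p.Prime] {D : ThetaSetting p}

/-! ### 1. Abstract surjective endomorphisms of `Ẑ` are injective -/

/-- **A surjective ABSTRACT group endomorphism of `Ẑ` is injective**: at each level `n` it is multiplication by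
`u_n := level_n(φ(η 1))` (`ZHatLevel.level_map`), surjectivity makes `u_n` a unit, and an element of `Ẑ` with all levels
`0` is trivial (`ZHatLevel.ext_of_level`). [cite: RibesZalesskii2010, Thm 2.7.1] -/
theorem zHat_monoidHom_injective_of_surjective (φ : ZHat →* ZHat) (hφ : Function.Surjective φ) :
    Function.Injective φ := by
  rw [injective_iff_map_eq_one]
  intro x hx
  refine ZHatLevel.ext_of_level fun n => ?_
  obtain ⟨y, hy⟩ := hφ (ZHatLevel.eta 1)
  have h1 := ZHatLevel.level_map n φ y
  rw [hy, ZHatLevel.level_eta, toAdd_ofAdd, Int.cast_one] at h1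
  have h2 := ZHatLevel.level_map n φ x
  rw [hx, map_one, toAdd_one] at h2
  apply Multiplicative.toAdd.injective
  rw [map_one, toAdd_one]
  calc Multiplicative.toAdd (ZHatLevel.level n x)
      = (Multiplicative.toAdd (ZHatLevel.level n (φ (ZHatLevel.eta 1))) *
          Multiplicative.toAdd (ZHatLevel.level n y)) * Multiplicative.toAdd (ZHatLevel.level n x) := by
        rw [← h1, one_mul]
    _ = Multiplicative.toAdd (ZHatLevel.level n y) *
          (Multiplicative.toAdd (ZHatLevel.level n (φ (ZHatLevel.eta 1))) *
            Multiplicative.toAdd (ZHatLevel.level n x)) := by ring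
    _ = 0 := by rw [← h2, mul_zero]

/-! ### 2. The cyclotomic topological trivialisation of the cusp inertia -/

/-- **«`I_x ≅ Ẑ(1)`» as a topological Galois-module isomorphism, derived.**  At `IsEtThOrigin` + `hYcl` + `IsTateOrigin` +
R2 (every `N`), for a cusp `x` with `D_x ⊆ Π^tp_Y` satisfying the cusp law C3 `toTheta(I_x) = Δ_Θ`, there is a
topological group isomorphism `e : I_x ≃ₜ* Ẑ` with `e(d w d⁻¹) = χ(aug d) (e w)` for all `d ∈ D_x`, `w ∈ I_x`.
[cite: MochizukiEtTh2009, Def 2.1 p.35] -/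
theorem IsTateOrigin.exists_cyclotomic_inertia_equiv (hO : D.IsEtThOrigin)
    (hYcl : (D.DtpY.map D.toHat.toMonoidHom).topologicalClosure ≤
      D.DtpY.map D.toHat.toMonoidHom ⊔ (⁅⁅D.DeltaHat, D.DeltaHat⁆, D.DeltaHat⁆).topologicalClosure)
    (hT : D.IsTateOrigin) (hR2 : ∀ N : ℕ+, GtpYNFromCusp D N) {x : D.Pt} (hx : D.IsCusp x)
    (hP3 : D.decomp x ≤ D.GtpY) (hC3 : (D.inertia x).map D.toTheta = D.DeltaTheta) :
    ∃ e : ↥(D.inertia x) ≃ₜ* ZHat, ∀ (d : D.PiTemp) (hd : d ∈ D.decomp x) (w : ↥(D.inertia x)),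
      e ⟨d * w * d⁻¹, conj_mem_inf_deltaTemp hd w.2⟩ = SettingModel.chi p (D.aug d) (e w) := by
  obtain ⟨ψ⟩ := hO.nonempty_deltaTheta_mulEquiv_zHat hYcl
  have hle : (D.inertia x).map D.toTheta ≤ D.DeltaTheta := hC3.le
  -- `fI := ψ ∘ θ|_{I_x}`
  set fI : ↥(D.inertia x) →* ZHat :=
    ψ.toMonoidHom.comp ((Subgroup.inclusion hle).comp ((D.toTheta).subgroupMap (D.inertia x))) with hfI_def
  have hfI : ∀ (w : ↥(D.inertia x)) (h : D.toTheta (w : D.PiTemp) ∈ D.DeltaTheta),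
      fI w = ψ ⟨D.toTheta w, h⟩ := fun w h => rfl
  -- onto, by C3
  have hsurj : Function.Surjective fI := by
    intro t
    obtain ⟨s, hs⟩ := ψ.surjective t
    have hs' : (s : D.GtpTheta) ∈ (D.inertia x).map D.toTheta := by rw [hC3]; exact s.2
    obtain ⟨w, hw, hws⟩ := hs'
    refine ⟨⟨w, hw⟩, ?_⟩
    rw [hfI ⟨w, hw⟩ (hws ▸ s.2), ← hs]
    congr 1
    exact Subtype.ext hws
  -- the root's abstract trivialisation `ε : I_x ≃ₜ* Ẑ`
  obtain ⟨ε₀⟩ := D.inertia_equiv_zHat x hx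
  have ε : ↥(D.inertia x) ≃ₜ* ZHat := ε₀
  -- `g := fI ∘ ε⁻¹`, an abstract endomorphism of `Ẑ`: surjective, hence injective; continuous
  let g : ZHat →* ZHat := fI.comp ε.symm.toMulEquiv.toMonoidHom
  have hg_apply : ∀ t, g t = fI (ε.symm t) := fun t => rfl
  have hg_surj : Function.Surjective g := by
    intro t
    obtain ⟨w, hw⟩ := hsurj t
    exact ⟨ε w, by rw [hg_apply, ContinuousMulEquiv.symm_apply_apply, hw]⟩
  have hg_inj : Function.Injective g := zHat_monoidHom_injective_of_surjective g hg_surj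
  have hg_cont : Continuous g := ZHatLevel.continuous_monoidHom g
  have hfI_eq : ∀ w, fI w = g (ε w) := fun w => by rw [hg_apply, ContinuousMulEquiv.symm_apply_apply]
  have hinj : Function.Injective fI := by
    intro a b h
    rw [hfI_eq, hfI_eq] at h
    exact ε.injective (hg_inj h)
  have hcont : Continuous fI := by
    have heq : (fI : ↥(D.inertia x) → ZHat) = g ∘ ε := funext hfI_eq
    rw [heq]
    exact hg_cont.comp ε.continuous
  -- `I_x` is compact (homeomorphic to `Ẑ`), `Ẑ` is Hausdorff: the continuous bijection `fI` is a homeomorphism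
  haveI : CompactSpace ↥(D.inertia x) := ε.symm.toHomeomorph.compactSpace
  let E : ↥(D.inertia x) ≃ ZHat := Equiv.ofBijective fI ⟨hinj, hsurj⟩
  have hE : Continuous E := hcont
  refine ⟨{ E with
      map_mul' := map_mul fI
      continuous_toFun := hE
      continuous_invFun := Continuous.continuous_symm_of_equiv_compact_to_t2 hE }, fun d hd w => ?_⟩
  obtain ⟨h₁, h₂, h⟩ := hT.inertiaCharacter_eq_chi hO hYcl hR2 ⟨x, hx, 1, (one_smul _ _).symm⟩ hP3 ψ d w.2
  change fI ⟨d * w * d⁻¹, _⟩ = SettingModel.chi p (D.aug d) (fI w)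
  rw [hfI _ h₁, hfI w h₂, h]

/-- **Joint-origin form** (`IsThm16Origin` supplies R2, abc-iut-L2-t7's `CuspLaws` supplies C3): for a cusp `x` with
`D_x ⊆ Π^tp_Y`, `I_x ≃ₜ* Ẑ` equivariantly for `χ`. [cite: MochizukiEtTh2009, Def 2.1 p.35] -/
theorem exists_cyclotomic_inertia_equiv_of_origins (hO : D.IsEtThOrigin)
    (hYcl : (D.DtpY.map D.toHat.toMonoidHom).topologicalClosure ≤
      D.DtpY.map D.toHat.toMonoidHom ⊔ (⁅⁅D.DeltaHat, D.DeltaHat⁆, D.DeltaHat⁆).topologicalClosure)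
    (h16 : D.IsThm16Origin) (hT : D.IsTateOrigin) (hL : D.CuspLaws) {x : D.Pt} (hx : D.IsCusp x)
    (hP3 : D.decomp x ≤ D.GtpY) :
    ∃ e : ↥(D.inertia x) ≃ₜ* ZHat, ∀ (d : D.PiTemp) (hd : d ∈ D.decomp x) (w : ↥(D.inertia x)),
      e ⟨d * w * d⁻¹, conj_mem_inf_deltaTemp hd w.2⟩ = SettingModel.chi p (D.aug d) (e w) :=
  hT.exists_cyclotomic_inertia_equiv hO hYcl h16.gtpYN_fromCusp hx hP3 (hL.map_toTheta_inertia x hx)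

/-- **… with (P3) from the parameter bundle `OncePuncturedData`**: at a joint origin with `CuspLaws`, EVERY cusp has a
cyclotomic topological trivialisation of its inertia. [cite: MochizukiEtTh2009, Def 2.1 p.35] -/
theorem exists_cyclotomic_inertia_equiv_of_oncePuncturedData (hO : D.IsEtThOrigin)
    (hYcl : (D.DtpY.map D.toHat.toMonoidHom).topologicalClosure ≤
      D.DtpY.map D.toHat.toMonoidHom ⊔ (⁅⁅D.DeltaHat, D.DeltaHat⁆, D.DeltaHat⁆).topologicalClosure)
    (h16 : D.IsThm16Origin) (hT : D.IsTateOrigin) (hL : D.CuspLaws) (P : D.OncePuncturedData) {x : D.Pt}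
    (hx : D.IsCusp x) :
    ∃ e : ↥(D.inertia x) ≃ₜ* ZHat, ∀ (d : D.PiTemp) (hd : d ∈ D.decomp x) (w : ↥(D.inertia x)),
      e ⟨d * w * d⁻¹, conj_mem_inf_deltaTemp hd w.2⟩ = SettingModel.chi p (D.aug d) (e w) :=
  D.exists_cyclotomic_inertia_equiv_of_origins hO hYcl h16 hT hL hx (P.decomp_le_ker_toZ x hx)

end ThetaSetting

end Literature.AnabelianGeometry.EtaleTheta

end
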